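import Summits.QuantumFields.BalabanUV.Beta.RowD1JointEndSymWardFold
import Summits.QuantumFields.BalabanUV.Beta.SymmetrisedStepJetsParity

/-!
# `BalabanUV.Beta.RowD1JointEndSymWardTables` — binder row D1: **THE LITERAL ROOT `D1Drift Lc (JsB12Sym hLc N tabs cΛ cB) Nc μ ν` WITH EVERY hW-SIDE
# LETTER A STATEMENT ABOUT an1's TABLE VALUES** — `RowD1JointEndSymWardFold` (p266787: (St)(Wt)(Sd)(Sr-conj)(Wd) and (c1) discharged) with the row
# parities (Sp)(Mp) REPLACED by the table parities (V-p) of `tabs.V` and (H-p) of `tabs.H` (`SymmetrisedStepJetsParity.trK_SpureSymOf` ∕ `trK_M1Of` under (M-H))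
# (β sub-cell, BINDER-OWNERS row D1 OWNER `b2b-balaban-beta-an2`, gen 29; successor brick of [AN2-G29-LANDED-WARD])

HONEST FRAMING (cell charter, verbatim): «discharging BetaPertH makes Bałaban's UV stability UNCONDITIONAL — a real constructive-QFT result; it is
NOT the continuum limit and NOT the Clay problem.»  HONEST DEPENDENCY: continuum YM on T⁴ ⇐ BetaPertH ∧ nine spine estimates (0/9 proved);
BetaPertH ⇐ (D1) ∧ (D4) ∧ CAP+tail; G-an2-4 gates asym, D1 and NE2/3/4.
DERIVED cell leaf ([folklore] wiring BY NAME).  No statement of Bałaban's papers, no `[cite:]`, no `Prop` fact, no `def`.  EVERY hypothesis below is a displayed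
BINDER.  The hW side of the (0.4) literal's root now reads, ENTIRELY at the level of an1's tables: (S-V)⁰⁴ (`tabs.V`), (M-H) (`tabs.M` vs `tabs.H`), (V-p)(H-p)
(parities of `tabs.V`, `tabs.H`), and the second-order letters (T2-W) (Wilson bi-table `Lc⁸ • wilsonW₂ 3 ((8N²)⁻¹ • wsym22 N)`), (T2-B) (`tabs.vh₂S` vs `tabs.V`),
(T2-M₂) (`M2Of tabs.mixFF` vs `tabs.M`) with their remainders' classes and parities; the hR side is p260870's ((V-r)(V-ff0)(H-r), `γ`, (Wr-conj-c), `X₂`, `Wc`,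
`hcomp`); then D1Tel, D1Rep, the printed B5 facts and the window.  HONEST: composition by name; discharges NO table letter; root-level classes 0∕5; tables 0∕5;
NOT D1, NOT `BetaPertH`, NOT continuum, NOT Clay.
Provenance: β sub-cell, unit beta-an2 gen 29, 2026-08-21 (v1); over `RowD1JointEndSymWardFold` and `SymmetrisedStepJetsParity` BY NAME; no existing file touched.
-/

noncomputable section

open Finset
open scoped BigOperators
open Literature.MathematicalPhysics.QuantumFieldTheory
open Literature.MathematicalPhysics.QuantumFieldTheory.Balaban1983to89
open Literature.MathematicalPhysics.QuantumFieldTheory.Balaban1983to89.Beta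
open Literature.MathematicalPhysics.QuantumFieldTheory.Balaban1983to89.Beta.VectorTailsLoc (fam kfam)
open Literature.MathematicalPhysics.QuantumFieldTheory.Balaban1983to89.Beta.VectorLegVolumeAdapter (MvE)
open ExpKernelCalculus (MKer BiLoc VertexFamily comp tr tadpole shiftK)
open PolarizationSign (reflSign WardTransversal AxisReflectionCovariant)
open KernelReflection (refK)
open ResolventReflection (bref Φ)
open AffineAveraging (box toSite)
open AveragingContoursRooted (ctr ctrOff ctrOff_mem_box)
open OneStepResolventKernel (Fib LocStencil JetData)
open OneStepKernelFamily (KInvStep vertexOfK TbalOf flipK D1Tel D1Rep D1Drift)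
open KernelWard (divV divW)
open StepJetData (mfNeg wilsonA)
open BalabanStepJetsSucc (wVH)
open SecondOrderResponse (dM)
open BalabanStepW2 (M2Of wB2)
open WilsonBiStencil (wilsonW₂)
open WilsonVertex2Sym (wsym22)
open Summit.QuantumFields.BalabanUV.Beta.TameKernelCalculus
open Summit.QuantumFields.BalabanUV.Beta.ChartConjugation (conjV conjW)
open Summit.QuantumFields.BalabanUV.Beta.ChartConjugationDefectEnd (conjDefect)
open Summit.QuantumFields.BalabanUV.Beta.AxialDressingRooted (one_le_of_neZero)
open Summit.QuantumFields.BalabanUV.Beta.SymmetrisedDressingKernel (coDressKSymAt)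
open Summit.QuantumFields.BalabanUV.Beta.AveragingWardRootedStencils (legInd)
open Summit.QuantumFields.BalabanUV.Beta.SymmetrisedStepJets (SymTables Gsym SsymOf SpureSymOf JsB12Sym0 JsB12Sym)
open Summit.QuantumFields.BalabanUV.Beta.SpineRooted (M1Of)
open Summit.QuantumFields.BalabanUV.Beta.SymShiftedSpread (bhKStepSh)
open Summit.QuantumFields.BalabanUV.Beta.BorderedHessian (sgnK bhK stepScale diagK)
open Summit.QuantumFields.BalabanUV.Beta.E3ContactGenerator (ctGenM)
open Summit.QuantumFields.BalabanUV.Beta.DshAn1 (Dsh linSym04At)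
open Summit.QuantumFields.BalabanUV.Beta.SymmetrisedStepJetsParity (trK_SpureSymOf trK_M1Of)
open Summit.QuantumFields.BalabanUV.Beta.RowD1JointEndSymWardFold (d1Drift_JsB12Sym_of_an1Shift_wardTables_multiplierTable_reflLetters_D1Tel_D1Rep)

namespace Summit.QuantumFields.BalabanUV.Beta.RowD1JointEndSymWardTables

variable {Lc : ℕ} [NeZero Lc]

/-- **ROW D1 — THE LITERAL ROOT AT an1's TYPED SHIFT WITH (St)(Wt)(Sd)(Sr-conj)(Wd)(c1)(Sp)(Mp) DISCHARGED; EVERY hW-SIDE LETTER IS A TABLE STATEMENT**: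
`RowD1JointEndSymWardFold.d1Drift_JsB12Sym_of_an1Shift_wardTables_multiplierTable_reflLetters_D1Tel_D1Rep` with (Sp) supplied by
`SymmetrisedStepJetsParity.trK_SpureSymOf` from (V-p)(H-p) and (Mp) by `trK_M1Of` from (H-p) under (M-H).  Every other binder VERBATIM.  HONEST: composition by
name; 0∕5 root-level classes; tables 0∕5; NOT D1. -/
theorem d1Drift_JsB12Sym_of_an1Shift_wardTables_tableParity_reflLetters_D1Tel_D1Rep (hLc : Odd Lc) (hL2 : 2 ≤ Lc) (N : ℕ) (tabs : SymTables 3 Lc) (cΛ cB : ℝ)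
    -- hW, first order: the (0.4) stencil Ward law of `tabs.V` ((S-V)⁰⁴, an1's `hVd_iff` form of (V-d))
    (hVd04 : ∀ u : Fin 4 → ℤ, divV tabs.V u = conjV (mfNeg (linSym04At (ctr 4 Lc) Lc)) (diagK (legInd (ctr 4 Lc) u)))
    -- hW, SECOND ORDER — THE TABLE LETTERS replacing the (Wd) socket of the root of record:
    -- (M-H) THE MULTIPLIER TABLES ARE THE `M1Of`-TABLES OF THE CONSTRAINT HESSIAN (an1's value [AN1-G39-R7] Q-R41-1 (i); replaces (c1), whose K part is now
    -- the theorem `LagrangeFoldSym.dM_SpureRecOf_M1Of_eq_vertexOfK_SrecOf`)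
    (hM1 : ∀ (j : ℕ) (ρ : Fin 4) (w : Fin 4 → ℤ), tabs.M j ρ w = M1Of 3 Lc tabs.H cΛ j ρ w)
    -- (V-p)(H-p) the row parities of the border table and of the constraint-Hessian table (replace (Sp)(Mp): `SymmetrisedStepJetsParity`)
    (hVp : ∀ (κ : Fin 4) (u : Fin 4 → ℤ), trK (tabs.V κ u) = -sgnK (tabs.V κ u))
    (hHp : ∀ (μ : Fin 4) (y : Fin 4 → ℤ), trK (tabs.H μ y) = -sgnK (tabs.H μ y))
    -- the second-order letters' remainders, their classes (one rate per level) and row parities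
    (RW RW'' : (Fin 4 → ℤ) → Fin 4 → (Fin 4 → ℤ) → MKer 4 (Fib 3))
    (RB RB'' : ℕ → (Fin 4 → ℤ) → Fin 4 → (Fin 4 → ℤ) → MKer 4 (Fib 3))
    (RM : ℕ → (Fin 4 → ℤ) → Fin 4 → (Fin 4 → ℤ) → MKer 4 (Fib 3))
    (hcls0 : ∃ C δ : ℝ, 0 < δ ∧ (∀ Y, LocStencil (RW Y) C δ) ∧ (∀ Y, LocStencil (RW'' Y) C δ) ∧ (∀ Y, LocStencil (RB 0 Y) C δ) ∧
      (∀ Y, LocStencil (RB'' 0 Y) C δ) ∧ (∀ y, VertexFamily (RM 0 y) Lc C δ))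
    (hclsS : ∀ j : ℕ, ∃ C δ : ℝ, 0 < δ ∧ (∀ Y, LocStencil (RB (j + 1) Y) C δ) ∧ (∀ Y, LocStencil (RB'' (j + 1) Y) C δ) ∧
      (∀ y, VertexFamily (RM (j + 1) y) Lc C δ))
    (hRWp : ∀ Y κ u, trK (RW Y κ u) = -sgnK (RW Y κ u)) (hRW''p : ∀ Y κ u, trK (RW'' Y κ u) = -sgnK (RW'' Y κ u))
    (hRBp : ∀ j Y κ u, trK (RB j Y κ u) = -sgnK (RB j Y κ u)) (hRB''p : ∀ j Y κ u, trK (RB'' j Y κ u) = -sgnK (RB'' j Y κ u))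
    (hRMp : ∀ j y ρ' w, trK (RM j y ρ' w) = -sgnK (RM j y ρ' w))
    -- (T2-W) the level-0 Ward law of the Wilson bi-table `Lc⁸ • wilsonW₂ 3 ((8N²)⁻¹ • wsym22 N)` against `Lc⁴ • wilsonA 3`, both slots
    (hWil : ∀ (Y : Fin 4 → ℤ) (κ' : Fin 4) (u' : Fin 4 → ℤ),
      (stepScale 3 Lc 0 * (Lc : ℝ) ^ (3 + 1))⁻¹ • ∑ v ∈ box (3 + 1) Lc,
          divV (fun κ u => ((Lc : ℝ) ^ 8) • wilsonW₂ 3 ((8 * (N : ℝ) ^ 2)⁻¹ • wsym22 N) κ u κ' u') ((Lc : ℤ) • Y + toSite v) =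
        comp (((Lc : ℝ) ^ (3 + 1)) • wilsonA 3 κ' u') (diagK ((1 / 2 : ℝ) • ∑ v ∈ box (3 + 1) Lc, legInd (ctr (3 + 1) Lc) ((Lc : ℤ) • Y + toSite v)))
          - comp (diagK ((1 / 2 : ℝ) • ∑ v ∈ box (3 + 1) Lc, legInd (ctr (3 + 1) Lc) ((Lc : ℤ) • Y + toSite v))) (((Lc : ℝ) ^ (3 + 1)) • wilsonA 3 κ' u') + RW Y κ' u')
    (hWil'' : ∀ (Y : Fin 4 → ℤ) (κ : Fin 4) (u : Fin 4 → ℤ),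
      (stepScale 3 Lc 0 * (Lc : ℝ) ^ (3 + 1))⁻¹ • ∑ v ∈ box (3 + 1) Lc,
          divV (fun κ' u' => ((Lc : ℝ) ^ 8) • wilsonW₂ 3 ((8 * (N : ℝ) ^ 2)⁻¹ • wsym22 N) κ u κ' u') ((Lc : ℤ) • Y + toSite v) =
        comp (((Lc : ℝ) ^ (3 + 1)) • wilsonA 3 κ u) (diagK ((1 / 2 : ℝ) • ∑ v ∈ box (3 + 1) Lc, legInd (ctr (3 + 1) Lc) ((Lc : ℤ) • Y + toSite v)))
          - comp (diagK ((1 / 2 : ℝ) • ∑ v ∈ box (3 + 1) Lc, legInd (ctr (3 + 1) Lc) ((Lc : ℤ) • Y + toSite v))) (((Lc : ℝ) ^ (3 + 1)) • wilsonA 3 κ u) + RW'' Y κ u)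
    -- (T2-B) the Ward law of the second-order border table `tabs.vh₂S` against `tabs.V`, both slots, level 0 and level j+1
    (hBord0 : ∀ (Y : Fin 4 → ℤ) (κ' : Fin 4) (u' : Fin 4 → ℤ),
      (stepScale 3 Lc 0 * (Lc : ℝ) ^ (3 + 1))⁻¹ • ∑ v ∈ box (3 + 1) Lc, divV (fun κ u => cB • tabs.vh₂S κ u κ' u') ((Lc : ℤ) • Y + toSite v) =
        comp ((-((Lc : ℝ) ^ (3 + 1) * (1 / 2) * (Lc : ℝ) ^ (3 + 1))) • tabs.V κ' u') (diagK ((1 / 2 : ℝ) • ∑ v ∈ box (3 + 1) Lc, legInd (ctr (3 + 1) Lc) ((Lc : ℤ) • Y + toSite v)))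
          - comp (diagK ((1 / 2 : ℝ) • ∑ v ∈ box (3 + 1) Lc, legInd (ctr (3 + 1) Lc) ((Lc : ℤ) • Y + toSite v))) ((-((Lc : ℝ) ^ (3 + 1) * (1 / 2) * (Lc : ℝ) ^ (3 + 1))) • tabs.V κ' u') + RB 0 Y κ' u')
    (hBord0'' : ∀ (Y : Fin 4 → ℤ) (κ : Fin 4) (u : Fin 4 → ℤ),
      (stepScale 3 Lc 0 * (Lc : ℝ) ^ (3 + 1))⁻¹ • ∑ v ∈ box (3 + 1) Lc, divV (fun κ' u' => cB • tabs.vh₂S κ u κ' u') ((Lc : ℤ) • Y + toSite v) =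
        comp ((-((Lc : ℝ) ^ (3 + 1) * (1 / 2) * (Lc : ℝ) ^ (3 + 1))) • tabs.V κ u) (diagK ((1 / 2 : ℝ) • ∑ v ∈ box (3 + 1) Lc, legInd (ctr (3 + 1) Lc) ((Lc : ℤ) • Y + toSite v)))
          - comp (diagK ((1 / 2 : ℝ) • ∑ v ∈ box (3 + 1) Lc, legInd (ctr (3 + 1) Lc) ((Lc : ℤ) • Y + toSite v))) ((-((Lc : ℝ) ^ (3 + 1) * (1 / 2) * (Lc : ℝ) ^ (3 + 1))) • tabs.V κ u) + RB'' 0 Y κ u)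
    (hBordS : ∀ (j : ℕ) (Y : Fin 4 → ℤ) (κ' : Fin 4) (u' : Fin 4 → ℤ),
      (stepScale 3 Lc (j + 1) * (Lc : ℝ) ^ (3 + 1))⁻¹ • ∑ v ∈ box (3 + 1) Lc, divV (fun κ u => (cB * wB2 3 Lc (j + 1)) • tabs.vh₂S κ u κ' u') ((Lc : ℤ) • Y + toSite v) =
        comp (((-((Lc : ℝ) ^ (3 + 1) * (1 / 2) * (Lc : ℝ) ^ (3 + 1))) * wVH 3 Lc (j + 1)) • tabs.V κ' u') (diagK ((1 / 2 : ℝ) • ∑ v ∈ box (3 + 1) Lc, legInd (ctr (3 + 1) Lc) ((Lc : ℤ) • Y + toSite v)))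
          - comp (diagK ((1 / 2 : ℝ) • ∑ v ∈ box (3 + 1) Lc, legInd (ctr (3 + 1) Lc) ((Lc : ℤ) • Y + toSite v))) (((-((Lc : ℝ) ^ (3 + 1) * (1 / 2) * (Lc : ℝ) ^ (3 + 1))) * wVH 3 Lc (j + 1)) • tabs.V κ' u') + RB (j + 1) Y κ' u')
    (hBordS'' : ∀ (j : ℕ) (Y : Fin 4 → ℤ) (κ : Fin 4) (u : Fin 4 → ℤ),
      (stepScale 3 Lc (j + 1) * (Lc : ℝ) ^ (3 + 1))⁻¹ • ∑ v ∈ box (3 + 1) Lc, divV (fun κ' u' => (cB * wB2 3 Lc (j + 1)) • tabs.vh₂S κ u κ' u') ((Lc : ℤ) • Y + toSite v) =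
        comp (((-((Lc : ℝ) ^ (3 + 1) * (1 / 2) * (Lc : ℝ) ^ (3 + 1))) * wVH 3 Lc (j + 1)) • tabs.V κ u) (diagK ((1 / 2 : ℝ) • ∑ v ∈ box (3 + 1) Lc, legInd (ctr (3 + 1) Lc) ((Lc : ℤ) • Y + toSite v)))
          - comp (diagK ((1 / 2 : ℝ) • ∑ v ∈ box (3 + 1) Lc, legInd (ctr (3 + 1) Lc) ((Lc : ℤ) • Y + toSite v))) (((-((Lc : ℝ) ^ (3 + 1) * (1 / 2) * (Lc : ℝ) ^ (3 + 1))) * wVH 3 Lc (j + 1)) • tabs.V κ u) + RB'' (j + 1) Y κ u)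
    -- (T2-M₂) the Ward law of the mixed table `M2Of tabs.mixFF j` against `tabs.M j`, every level
    (hM₂ : ∀ (j : ℕ) (y : Fin 4 → ℤ) (ρ' : Fin 4) (w : Fin 4 → ℤ),
      (stepScale 3 Lc j * (Lc : ℝ) ^ (3 + 1))⁻¹ • ∑ v ∈ box (3 + 1) Lc, divV (fun κ u => M2Of 3 Lc tabs.mixFF j κ u ρ' w) ((Lc : ℤ) • y + toSite v) =
        comp (tabs.M j ρ' w) (diagK ((1 / 2 : ℝ) • ∑ v ∈ box (3 + 1) Lc, legInd (ctr (3 + 1) Lc) ((Lc : ℤ) • y + toSite v))) - comp (diagK ((1 / 2 : ℝ) • ∑ v ∈ box (3 + 1) Lc, legInd (ctr (3 + 1) Lc) ((Lc : ℤ) • y + toSite v))) (tabs.M j ρ' w) + RM j y ρ' w)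
    -- hR, first order: the tables' REFLECTION letters (V-r)(V-ff0)(H-r) — VERBATIM from the root of record
    (hVfm : ∀ (α κ' : Fin 4) (u x z : Fin 4 → ℤ) (β m : Fin 4), tabs.V κ' (bref α κ' u) x z (Sum.inl β) (Sum.inr m) =
      (reflSign α κ' • refK (Φ (d := 3) Lc α) (tabs.V κ' u + conjV (bhK (d := 3) Lc + Dsh Lc)
        ((((Lc : ℝ) ^ 4)⁻¹) • diagK (ctGenM 3 (bhK Lc + Dsh Lc) α Lc κ' u)))) x z (Sum.inl β) (Sum.inr m))
    (hVmf : ∀ (α κ' : Fin 4) (u x z : Fin 4 → ℤ) (m β : Fin 4), tabs.V κ' (bref α κ' u) x z (Sum.inr m) (Sum.inl β) =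
      (reflSign α κ' • refK (Φ (d := 3) Lc α) (tabs.V κ' u + conjV (bhK (d := 3) Lc + Dsh Lc)
        ((((Lc : ℝ) ^ 4)⁻¹) • diagK (ctGenM 3 (bhK Lc + Dsh Lc) α Lc κ' u)))) x z (Sum.inr m) (Sum.inl β))
    (hVmm : ∀ (α κ' : Fin 4) (u x z : Fin 4 → ℤ) (m m' : Fin 4), tabs.V κ' (bref α κ' u) x z (Sum.inr m) (Sum.inr m') =
      (reflSign α κ' • refK (Φ (d := 3) Lc α) (tabs.V κ' u + conjV (bhK (d := 3) Lc + Dsh Lc)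
        ((((Lc : ℝ) ^ 4)⁻¹) • diagK (ctGenM 3 (bhK Lc + Dsh Lc) α Lc κ' u)))) x z (Sum.inr m) (Sum.inr m'))
    (hV0 : ∀ (κ : Fin 4) (w x z : Fin 4 → ℤ) (β β' : Fin 4), tabs.V κ w x z (Sum.inl β) (Sum.inl β') = 0)
    (hHr : ∀ (α μ : Fin 4) (y : Fin 4 → ℤ), tabs.H μ (bref α μ y) = reflSign α μ • refK (Φ (d := 3) Lc α) (tabs.H μ y))
    -- the first-order contact coefficient, displayed
    (γ : ℕ → ℝ) (hγ : ∀ j, γ j = -((Lc : ℝ) ^ 8 / 2) * wVH 3 Lc j / (stepScale 3 Lc j * (Lc : ℝ) ^ 4))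
    -- hR, second order, with the PINNED first-order contacts
    (X₂ Wc : ℕ → Fin 4 → Fin 4 → (Fin 4 → ℤ) → Fin 4 → (Fin 4 → ℤ) → MKer 4 (Fib 3))
    (hX₂ : ∀ j α μ y ν y', Loc (X₂ j α μ y ν y')) (hWc : ∀ j α μ y ν y', Loc (Wc j α μ y ν y'))
    (hWrC : ∀ (j : ℕ) (α μ : Fin 4) (y : Fin 4 → ℤ) (ν : Fin 4) (y' : Fin 4 → ℤ),
      (JsB12Sym0 hLc N tabs cΛ cB j).W μ (bref α μ y) ν (bref α ν y') = (reflSign α μ * reflSign α ν) • refK (Φ Lc α) ((JsB12Sym0 hLc N tabs cΛ cB j).W μ y ν y' +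
        conjW (bhKStepSh 3 Lc (Dsh Lc) j) (vertexOfK (coDressKSymAt (toSite (ctrOff 4 Lc)) Lc (KInvStep (d := 3) Lc j)) Lc (JsB12Sym0 hLc N tabs cΛ cB j).S μ y)
          (vertexOfK (coDressKSymAt (toSite (ctrOff 4 Lc)) Lc (KInvStep (d := 3) Lc j)) Lc (JsB12Sym0 hLc N tabs cΛ cB j).S ν y')
          (vertexOfK (coDressKSymAt (toSite (ctrOff 4 Lc)) Lc (KInvStep (d := 3) Lc j)) Lc (fun κ u => γ j • diagK (ctGenM 3 (bhK Lc + Dsh Lc) α Lc κ u)) μ y)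
          (vertexOfK (coDressKSymAt (toSite (ctrOff 4 Lc)) Lc (KInvStep (d := 3) Lc j)) Lc (fun κ u => γ j • diagK (ctGenM 3 (bhK Lc + Dsh Lc) α Lc κ u)) ν y')
          (X₂ j α μ y ν y')
          + Wc j α μ y ν y'))
    (hcomp : ∀ (j : ℕ) (α μ : Fin 4) (y : Fin 4 → ℤ) (ν : Fin 4) (y' : Fin 4 → ℤ),
      (1 / 2 : ℝ) * tadpole (coDressKSymAt (toSite (ctrOff 4 Lc)) Lc (KInvStep (d := 3) Lc j)) (Wc j α μ y ν y')
        + conjDefect (coDressKSymAt (toSite (ctrOff 4 Lc)) Lc (KInvStep (d := 3) Lc j)) (bhKStepSh 3 Lc (Dsh Lc) j)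
            (vertexOfK (coDressKSymAt (toSite (ctrOff 4 Lc)) Lc (KInvStep (d := 3) Lc j)) Lc (JsB12Sym0 hLc N tabs cΛ cB j).S μ y)
            (vertexOfK (coDressKSymAt (toSite (ctrOff 4 Lc)) Lc (KInvStep (d := 3) Lc j)) Lc (JsB12Sym0 hLc N tabs cΛ cB j).S ν y')
            (vertexOfK (coDressKSymAt (toSite (ctrOff 4 Lc)) Lc (KInvStep (d := 3) Lc j)) Lc (fun κ u => γ j • diagK (ctGenM 3 (bhK Lc + Dsh Lc) α Lc κ u)) μ y)
            (vertexOfK (coDressKSymAt (toSite (ctrOff 4 Lc)) Lc (KInvStep (d := 3) Lc j)) Lc (fun κ u => γ j • diagK (ctGenM 3 (bhK Lc + Dsh Lc) α Lc κ u)) ν y')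
            (X₂ j α μ y ν y') = 0)
    -- the route theorem's own binders, verbatim
    (a : ℝ) (ha : 0 < a)
    (h12 : B5.Prop12Printed (fam (fun i : ℕ+ × ℕ => ((i.1 : ℕ+) : ℕ)) (fun i => i.1.pos) MvE a ha))
    (h126 : B5.Kernel126_127Printed (kfam (fun i : ℕ+ × ℕ => ((i.1 : ℕ+) : ℕ)) MvE))
    {L : Type*} {SL : Finset L} (hSL : SL.Nonempty) (k : L → Fin 4) {μ ν : Fin 4} (hμν : μ ≠ ν) {Nc : ℝ} (hNc : Nc ≠ 0)
    (Jc : ∀ m : ℕ, JetData 3 (Lc ^ m))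
    (htel : D1Tel Lc (JsB12Sym hLc N tabs cΛ cB) Jc)
    {cc : ℝ} {Mw' : ℕ → ℕ} (hc : 1 ≤ cc) (hMwin : ∀ L : ℕ, 2 ≤ L → 1 ≤ Mw' L ∧ (L : ℝ) ≤ cc * Mw' L) (hML : ∀ L : ℕ, 2 ≤ L → Mw' L ≤ L)
    (hrep : D1Rep Lc Jc Nc μ ν a SL k) :
    D1Drift Lc (JsB12Sym hLc N tabs cΛ cB) Nc μ ν :=
  d1Drift_JsB12Sym_of_an1Shift_wardTables_multiplierTable_reflLetters_D1Tel_D1Rep hLc hL2 N tabs cΛ cB hVd04 hM1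
    (fun j κ u => trK_SpureSymOf (d := 3) tabs hVp hHp _ _ cΛ j κ u)
    (fun j ρ w => by
      have e : tabs.M j = M1Of 3 Lc tabs.H cΛ j := funext fun ρ' => funext fun w' => hM1 j ρ' w'
      rw [e]
      exact trK_M1Of (d := 3) (Lc := Lc) hHp cΛ j ρ w)
    RW RW'' RB RB'' RM hcls0 hclsS hRWp hRW''p hRBp hRB''p hRMp hWil hWil'' hBord0 hBord0'' hBordS hBordS'' hM₂
    hVfm hVmf hVmm hV0 hHr γ hγ X₂ Wc hX₂ hWc hWrC hcomp a ha h12 h126 hSL k hμν hNc Jc htel hc hMwin hML hrep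

end Summit.QuantumFields.BalabanUV.Beta.RowD1JointEndSymWardTables

end
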